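import Mathlib.Algebra.MvPolynomial.Eval
import HarnessLib

/-!
# The coordinate equations of the formal-to-étale bridge as a polynomial system (the "bridge system")

Topic: `Literature/AlgebraicGeometry/Resolution`. The system of polynomial equations to which
Artin approximation (`Artin1969EtaleApproximation`, Artin 1969, Cor. 2.1) is applied in the
proof of `DeJong1996FormalNormalCrossings` (de Jong 1996, 4.25 (i)/4.28): with coefficients
`g₁, …, g_m` (generators of the ideal of the divisor on an affine chart) and `t₁, …, t_n`
(generators of the prime of the point), in the unknowns `y₁, …, y_d`, `a_j`, `b_j`, `c_{li}`,
`d_{il}`: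

  (E1) `g_j = a_j · ∏_{i < r} y_i`,  (E2) `∏_{i < r} y_i = ∑_j b_j g_j`,
  (E3) `t_l = ∑_i c_{li} y_i`,      (E4) `y_i = ∑_l d_{il} t_l`.

* `BridgeVar d m n` — the (finite) type of unknowns; `bridgeSystem d r gI t` — the polynomials
  (named "bridge system" to keep clear of the unrelated `CoordSystem` of
  `DerivativeIdealsCoordinates.lean`),
  indexed by the finite type `Fin m ⊕ Unit ⊕ Fin n ⊕ Fin d`;
* `bridgeSystem_eval₂_eq_zero_iff` — a family of values is a zero of the system (under a ring
  map `φ` of the coefficients) iff its components satisfy (E1)–(E4).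

## Sources

* M. Artin, *Algebraic approximation of structures over complete local rings*, Publ. Math.
  IHÉS 36 (1969), Cor. 2.1.
* A. J. de Jong, *Smoothness, semi-stability and alterations*, Publ. Math. IHÉS 83 (1996),
  4.25–4.28.
-/

noncomputable section

namespace Literature.AlgebraicGeometry.Resolution

/-- The unknowns of the bridge (polynomial) system: `y i`, `a j`, `b j`, `c (l, i)`, `d (i, l)`.
[folklore] -/
abbrev BridgeVar (d m n : ℕ) : Type :=
  Fin d ⊕ Fin m ⊕ Fin m ⊕ (Fin n × Fin d) ⊕ (Fin d × Fin n)

namespace BridgeVar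

variable {d m n : ℕ}

/-- The unknown `yᵢ`. [folklore] -/
abbrev y (i : Fin d) : BridgeVar d m n := Sum.inl i
/-- The unknown `aⱼ`. [folklore] -/
abbrev a (j : Fin m) : BridgeVar d m n := Sum.inr (Sum.inl j)
/-- The unknown `bⱼ`. [folklore] -/
abbrev b (j : Fin m) : BridgeVar d m n := Sum.inr (Sum.inr (Sum.inl j))
/-- The unknown `c_{li}`. [folklore] -/
abbrev c (l : Fin n) (i : Fin d) : BridgeVar d m n := Sum.inr (Sum.inr (Sum.inr (Sum.inl (l, i))))
/-- The unknown `d_{il}`. [folklore] -/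
abbrev dd (i : Fin d) (l : Fin n) : BridgeVar d m n := Sum.inr (Sum.inr (Sum.inr (Sum.inr (i, l))))

end BridgeVar

open _root_.MvPolynomial in
/-- **The bridge system (E1)–(E4)** over the coefficient ring `R`, as polynomials in the
unknowns `BridgeVar d m n`, indexed by `Fin m ⊕ Unit ⊕ Fin n ⊕ Fin d` (the equations
(E1)ⱼ, (E2), (E3)ₗ, (E4)ᵢ). [folklore] -/
def bridgeSystem {R : Type*} [CommRing R] (d r : ℕ) {m n : ℕ} (gI : Fin m → R) (t : Fin n → R) :
    Fin m ⊕ Unit ⊕ Fin n ⊕ Fin d → MvPolynomial (BridgeVar d m n) R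
  | Sum.inl j => C (gI j) -
      X (BridgeVar.a j) * ∏ i ∈ Finset.univ.filter (fun i : Fin d => (i : ℕ) < r), X (BridgeVar.y i)
  | Sum.inr (Sum.inl _) =>
      (∏ i ∈ Finset.univ.filter (fun i : Fin d => (i : ℕ) < r), X (BridgeVar.y i)) -
        ∑ j, X (BridgeVar.b j) * C (gI j)
  | Sum.inr (Sum.inr (Sum.inl l)) => C (t l) - ∑ i, X (BridgeVar.c l i) * X (BridgeVar.y i)
  | Sum.inr (Sum.inr (Sum.inr i)) => X (BridgeVar.y i) - ∑ l, X (BridgeVar.dd i l) * C (t l)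

/-- **Zeros of the bridge system are solutions of (E1)–(E4)**: for a ring map `φ : R → S`
and values `v` of the unknowns in `S`, all polynomials of `bridgeSystem` vanish at `v` iff the
components `y = v ∘ y`, `a`, `b`, `c`, `d` of `v` satisfy (E1)–(E4) with coefficients
`φ(g_j)`, `φ(t_l)`. [folklore] -/
theorem bridgeSystem_eval₂_eq_zero_iff {R S : Type*} [CommRing R] [CommRing S] (φ : R →+* S)
    {d r m n : ℕ} (gI : Fin m → R) (t : Fin n → R) (v : BridgeVar d m n → S) :
    (∀ κ, MvPolynomial.eval₂ φ v (bridgeSystem d r gI t κ) = 0) ↔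
      (∀ j, φ (gI j) = v (BridgeVar.a j) *
          ∏ i ∈ Finset.univ.filter (fun i : Fin d => (i : ℕ) < r), v (BridgeVar.y i)) ∧
      (∏ i ∈ Finset.univ.filter (fun i : Fin d => (i : ℕ) < r), v (BridgeVar.y i) =
          ∑ j, v (BridgeVar.b j) * φ (gI j)) ∧
      (∀ l, φ (t l) = ∑ i, v (BridgeVar.c l i) * v (BridgeVar.y i)) ∧
      (∀ i, v (BridgeVar.y i) = ∑ l, v (BridgeVar.dd i l) * φ (t l)) := by
  have hE : ∀ κ, MvPolynomial.eval₂ φ v (bridgeSystem d r gI t κ) = 0 ↔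
      (match κ with
        | Sum.inl j => φ (gI j) = v (BridgeVar.a j) *
            ∏ i ∈ Finset.univ.filter (fun i : Fin d => (i : ℕ) < r), v (BridgeVar.y i)
        | Sum.inr (Sum.inl _) =>
            ∏ i ∈ Finset.univ.filter (fun i : Fin d => (i : ℕ) < r), v (BridgeVar.y i) =
              ∑ j, v (BridgeVar.b j) * φ (gI j)
        | Sum.inr (Sum.inr (Sum.inl l)) => φ (t l) = ∑ i, v (BridgeVar.c l i) * v (BridgeVar.y i)
        | Sum.inr (Sum.inr (Sum.inr i)) => v (BridgeVar.y i) = ∑ l, v (BridgeVar.dd i l) * φ (t l)) := by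
    intro κ
    rcases κ with j | ⟨⟨⟩⟩ | l | i <;>
      · simp only [bridgeSystem]
        rw [← MvPolynomial.coe_eval₂Hom]
        simp only [map_sub, map_mul, map_prod, map_sum, MvPolynomial.eval₂Hom_C,
          MvPolynomial.eval₂Hom_X', sub_eq_zero]
  constructor
  · intro h
    refine ⟨fun j => (hE (Sum.inl j)).mp (h _), (hE (Sum.inr (Sum.inl ()))).mp (h _),
      fun l => (hE (Sum.inr (Sum.inr (Sum.inl l)))).mp (h _),
      fun i => (hE (Sum.inr (Sum.inr (Sum.inr i)))).mp (h _)⟩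
  · rintro ⟨h1, h2, h3, h4⟩ κ
    rcases κ with j | ⟨⟨⟩⟩ | l | i
    · exact (hE _).mpr (h1 j)
    · exact (hE _).mpr h2
    · exact (hE _).mpr (h3 l)
    · exact (hE _).mpr (h4 i)

end Literature.AlgebraicGeometry.Resolution

end
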